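import Summits.QuantumFields.YangMills.Theses.CheckerboardTriality
import Summits.QuantumFields.YangMills.Theorems.CheckerboardTrialitySigma3DenseUpgrade
import Summits.QuantumFields.YangMills.Theorems.CheckerboardTrialityHyperoctahedralRung
import Summits.QuantumFields.YangMills.Theorems.BalabanLadderROTOfKing
import HarnessLib

/-!
# Route `CheckerboardTriality`: the door `RotOfSigma3Limit` (stmt-QuantumFields-23424) — `Sigma3Limit → ROT` without triality

LINE g10-A «sigma3-twin» (planner ym-idea-1 g10), the census certificate requested by the critic of record (idea-crit-4, P1):
the Σ3 twin invariance of the UV limit points ALONE (`CheckerboardTriality.Sigma3Limit`, stmt-QuantumFields-23398, OPEN)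
implies the R2d rotation crux `BalabanLadder.ROT` — the triality item `TrialityLimit` (index 2) is NOT used.  Ingredients,
all in the tree: the W(B₄) rung (every off-diagonal limit point is invariant under the signed permutations of the axes,
`CheckerboardTrialityHyperoctahedral.signedPerm_invariant_of_offDiagLimitAlong`), the Σ3 density upgrade
(`Sigma3.planeRot_invariant_of_signedPerm_of_sigma3`, the content of the closed item `Sigma3DenseUpgrade`), and the King
closing `ROT.rot_of_kingLimit` (UV compactness from `MomentBounds6`, density of the Pythagorean angles).

Reading (census): modulo provable glue `Sigma3Limit ≡ ROT` (the converse `ROT → Sigma3Limit` is the trivial direction, since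
`g₃ ∈ SO(4)`; not filed); CheckerboardTriality = King's lane A at coincidence indices 2 and 3, two faces of ONE wall
(`Literature.Barriers` RegularisationDichotomy); third face `ROT.rot_of_kingSingleLimit` (index 5).  No definition, no named
fact, no sorry; standard axioms.  `Sigma3Limit`, `ROT`/R2d, the Bałaban ladder and the YM mass gap remain OPEN: nothing here
proves a crux, a leg, a rung or the summit.
-/

set_option autoImplicit false

noncomputable section

open scoped SchwartzMap
open MeasureTheory Filter Topology
open Literature.MathematicalPhysics.QuantumFieldTheory Literature.MathematicalPhysics.QuantumLattice
open Literature.MathematicalPhysics.AQFT Literature.Probability.LatticeModels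
open Summit.QuantumFields.YangMills.Cruxes.OSLegsFromFemtoAndGap.DlrCollarTransfer
open Summit.QuantumFields.YangMills.Cruxes.OSLegsAtWeakCouplingC.Sketch
open Summit.QuantumFields.YangMills.Cruxes.OSLegsAtWeakCouplingC.Y2Bridge
open Summit.QuantumFields.YangMills.Theorems.ROT
open Summit.QuantumFields.YangMills.Theorems.CheckerboardTrialityHyperoctahedral (signedPerm_invariant_of_offDiagLimitAlong)
open Summit.QuantumFields.YangMills.Theorems.Sigma3 (planeRot_invariant_of_signedPerm_of_sigma3)

namespace Summit.QuantumFields.YangMills.Theorems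

/-- **`Sigma3Limit → ROT` (no triality).** [C. King, CMP 103 (1986) Thm 2.4 — mechanism; OS1973 §2 (lattice symmetries)] -/
theorem checkerboardTriality_rot_of_sigma3Limit
    (h : Summit.QuantumFields.YangMills.Theses.CheckerboardTriality.Sigma3Limit) :
    Summit.QuantumFields.YangMills.Theses.BalabanLadder.ROT := by
  refine rot_of_kingLimit ?_
  intro G _ _ _ _ hG
  letI : MeasurableSpace G := borel G
  haveI : BorelSpace G := ⟨rfl⟩
  intro r a ha ha0 hUV sch hsch
  refine ⟨1, one_pos, fun φ hφ S₁ hS₁ n hn F hF θ _hθ => ?_⟩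
  exact planeRot_invariant_of_signedPerm_of_sigma3 S₁ hS₁.2.1
    (fun F' hF' R hR => signedPerm_invariant_of_offDiagLimitAlong r ha ha0 hUV hsch hφ hS₁ R hR n F' hF'.1)
    (fun F' hF' R hR => h G hG r a ha ha0 hUV sch hsch 1 one_pos φ hφ S₁ hS₁ n hn F' hF' R hR) F hF θ

/-- **Item stmt-QuantumFields-23424 `CheckerboardTriality.RotOfSigma3Limit` holds** (door / census certificate; aside, not
load-bearing for the route's `closes`). [C. King, CMP 103 (1986) Thm 2.4 — mechanism] -/
theorem checkerboardTriality_rotOfSigma3Limit_proof :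
    Summit.QuantumFields.YangMills.Theses.CheckerboardTriality.RotOfSigma3Limit :=
  fun h => checkerboardTriality_rot_of_sigma3Limit h

end Summit.QuantumFields.YangMills.Theorems

end
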